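import Summits.BirchSwinnertonDyer.BirchSwinnertonDyer.Theorems.ResidualThetaTransportAtTwoThetaLayerLambdaCongruenceAtTwoCuspSpanArtinReduction
import Summits.BirchSwinnertonDyer.BirchSwinnertonDyer.Theorems.ResidualThetaTransportAtTwoArtinDefs
import HarnessLib

/-!
# Route `ResidualThetaTransportAtTwo`, node (G′)_N (item 27436; cruxes Kan⁺ 20688 / Kμ⁺ 20689 / 21437): the node, the route item,
# Kan⁺ and the analytic child 21437 keyed on the REGISTERED conjecture `ArtinPrimitiveRootTwoAP` (width seat w4's `…ArtinDefs`, p629022)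

Cell `bsd-wall`, extra width seat `bsd-wall-rtt-p3-w5` g0 (2026-08-28). THEOREMS ONLY; helper `--supports stmt-BirchSwinnertonDyer-20688`;
BSD is not proved by this. GLUE between the two parallel kernel chains for `Lines/birth-generation.md` §4.2 (width seats w4 and w5 took the
same «Artin lane»; see the bus 11:10Z / 11:2xZ / 13:2xZ): w4 registered the hypothesis as the `@[conjecture]` definition
`SignedMuAtTwo.ArtinPrimitiveRootTwoAP` («for all `m, r` with `8 ∣ m`, `r ≡ 3 (mod 8)`, `gcd(r, m) = 1` and every `B` there is a prime `q > B`,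
`q ≡ r (mod m)`, with `orderOf (2 : ZMod q) = q − 1`»), while this seat's `…CuspSpanArtinReduction` (p630531) proves the node from the same
statement spelled inline. The one-liners below add, keyed on the registered definition, the two closers the parallel file `…CuspSpanArtinNamed` (w4) does not state:

* `artinProgression_of_artinPrimitiveRootTwoAP` — the registered conjecture gives the inline hypothesis (AP₃) of `cuspSpanEvenAtTwo_of_artin`
  («every non-zero residue mod `q` is a power of `2`», via `ArtinRoute.exists_two_pow_eq_of_orderOf`);
* `cuspSpanEvenAtTwoOdd_of_artinAP` — the route item 27436 `CuspSpanEvenAtTwoOdd` BY NAME from the registered conjecture (conditional;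
  not closed by this) — not among w4's `…CuspSpanArtinNamed` closers (which give `cuspSpanEvenAtTwo_of_artinAP`, `forall_…`, FLAT, 21437 and
  Kan⁺ via PUB⁷ + Abbes–Ullmo);
* `thetaLayerLambdaCongruenceAtTwo_of_pubHecke_of_artinAP` — Kan⁺ from the route's PUB⁵ bundle `PublishedInputsHeckeAtTwo` (item 27435) and the
  conjecture, through the landed glue 27454 (the route-rev-33 shape of the crux: PUB⁵ → node → Kan⁺).

`ArtinPrimitiveRootTwoAP` is Artin's primitive-root conjecture for `2` on progressions `≡ 3 (mod 8)`: a theorem under GRH (Lenstra 1977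
Thm. (8.3); Moree 1999 Thm. 2 and Thm. 4), open unconditionally; here it is a HYPOTHESIS — nothing is asserted, no item is closed.

References: H. W. Lenstra, Invent. Math. 42 (1977) 201–224 [Lenstra1977]; P. Moree, J. Number Theory 78 (1999) 85–98 [Moree1999];
R. Pollack, Duke Math. J. 118 (2003) Conj. 6.3 [Pollack2003].
-/

set_option autoImplicit false
set_option linter.dupNamespace false

noncomputable section

open scoped MatrixGroups

open CongruenceSubgroup

namespace Summit.BirchSwinnertonDyer.BirchSwinnertonDyer.Theorems.SignedMuAtTwo

/-- The registered conjecture `ArtinPrimitiveRootTwoAP` (w4, p629022) yields the inline hypothesis (AP₃) of `cuspSpanEvenAtTwo_of_artin`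
(«every non-zero residue mod `q` is a power of `2`»). [cite: Lenstra1977, Thm. (8.3)] [cite: Moree1999, Thm. 2] -/
theorem artinProgression_of_artinPrimitiveRootTwoAP (h : ArtinPrimitiveRootTwoAP) :
    ∀ (M r B : ℕ), 8 ∣ M → r % 8 = 3 → Nat.Coprime r M →
      ∃ q : ℕ, q.Prime ∧ B < q ∧ q ≡ r [MOD M] ∧ ∀ x : ZMod q, x ≠ 0 → ∃ i : ℕ, (2 : ZMod q) ^ i = x := by
  intro M r B hM hr hrM
  obtain ⟨q, hB, hq, hqr, hroot⟩ := h M r hM hr hrM B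
  exact ⟨q, hq, hB, hqr, ArtinRoute.exists_two_pow_eq_of_orderOf hq hroot⟩

/-- **The route item 27436 `CuspSpanEvenAtTwoOdd` from `ArtinPrimitiveRootTwoAP`** (conditional; the item is not closed by this).
[cite: Lenstra1977, Thm. (8.3)] [cite: Moree1999, Thm. 2 and Thm. 4] [cite: Pollack2003, Conj. 6.3] -/
theorem cuspSpanEvenAtTwoOdd_of_artinAP (h : ArtinPrimitiveRootTwoAP) :
    Summit.BirchSwinnertonDyer.BirchSwinnertonDyer.Theses.ResidualThetaTransportAtTwo.CuspSpanEvenAtTwoOdd :=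
  cuspSpanEvenAtTwoOdd_of_artin (artinProgression_of_artinPrimitiveRootTwoAP h)

/-- **Kan⁺ `ThetaLayerLambdaCongruenceAtTwo` (crux 20688) from the PUB⁵ bundle and `ArtinPrimitiveRootTwoAP`**, through the landed glue
27454. Conditional on the print binders and on the conjecture; nothing is closed. [cite: Lenstra1977, Thm. (8.3)] [cite: Pollack2003, Conj. 6.3] -/
theorem thetaLayerLambdaCongruenceAtTwo_of_pubHecke_of_artinAP
    (hPub : Summit.BirchSwinnertonDyer.BirchSwinnertonDyer.Theses.ResidualThetaTransportAtTwo.PublishedInputsHeckeAtTwo)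
    (h : ArtinPrimitiveRootTwoAP) :
    Summit.BirchSwinnertonDyer.BirchSwinnertonDyer.Theses.ResidualThetaTransportAtTwo.ThetaLayerLambdaCongruenceAtTwo :=
  thetaLayerLambdaCongruenceAtTwo_of_pub_of_artin hPub (artinProgression_of_artinPrimitiveRootTwoAP h)

end Summit.BirchSwinnertonDyer.BirchSwinnertonDyer.Theorems.SignedMuAtTwo

end
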